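import Summits.Parity.GeneralizedHardyLittlewood.Theorems.PrimeLevelFamEdgeMomentsBeyondDiagonalLayersClassCount
import Summits.Parity.GeneralizedHardyLittlewood.Theorems.PrimeLevelFamEdgeMomentsBeyondDiagonalLayersFormReductionZero
import HarnessLib

/-!
# Route `PrimeLevelFamEdge`, crux K_A `MomentsBeyondDiagonal` (stmt-Parity-20007), line «petersson_layers» v4:
# the class and block sums of the uniform per-class weight (assembly step E7, inputs)

Summation tools for `…LayersClassUniform.classTerm_le_uniform`'s weight `(d₁d₂)⁻¹ (s₁t₁s₂t₂)^{−1/12}`: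
* `inv_one_sub_two_rpow_neg_twelfth_le`, **`sum_rpow_neg_twelfth_factored_le`**: `Σ_{s ≤ X, s ∣ c^∞} s^{−1/12} ≤ C_ε c^ε`
  (Euler product `≤ (1 − 2^{−1/12})^{−ω(c)} ≤ 32^{ω(c)} ≤ τ(c)⁵`, as in `…LayersClassCount` for the exponent `−1/6`);
* `logFactor_cube_le_rpow`: `((1+log q̂)(1+2log q))^{i+j}·√(1+2log q)·(1+2log q)² ≤ C q̂^{1/1000}`;
* `classWeight_split`, `sum_four_weights_mul_eq`, **`sum_blocks_classes_le`**:
  `Σ_{d₁,d₂ ≤ M} Σ_{classes} G/(d₁d₂)·(s₁t₁s₂t₂)^{−1/12} ≤ G·(1+2log q)²·T⁴` when every class sum is `≤ T` and `M ≤ q²`.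
Proof only (def-free helper); K_A NOT proved; nothing about Landau–Siegel zeros.
-/

noncomputable section

open scoped Real Nat
open Complex Finset Polynomial MeasureTheory
open Literature.NumberTheory.LFunctions
open Literature.NumberTheory.Sieve

namespace Summit.Parity.GeneralizedHardyLittlewood.Theorems.MomentsBeyondDiagonal.Layers

open Summit.Parity.GeneralizedHardyLittlewood.Theorems.PrimeLevelFamEdgeIdeaDeltas.PeterssonLayers
open Summit.Parity.GeneralizedHardyLittlewood.Theorems.MomentsBeyondDiagonal.TwoOrderAFE
  (one_add_two_log_le one_add_log_pow_le_rpow)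

/-! ## §1. The class sum with exponent `−1/12` -/

/-- `(1 − 2^{−1/12})⁻¹ ≤ 32` (`2^{−1/12} ≤ 31/32` since `(31/32)¹² ≥ 1/2`). [folklore] -/
theorem inv_one_sub_two_rpow_neg_twelfth_le : (1 - (2 : ℝ) ^ (-(1 / 12 : ℝ)))⁻¹ ≤ 32 := by
  have hx : (2 : ℝ) ^ (-(1 / 12 : ℝ)) ≤ 31 / 32 := by
    have h12 : ((2 : ℝ) ^ (-(1 / 12 : ℝ))) ^ (12 : ℕ) = 1 / 2 := by
      rw [← Real.rpow_natCast, ← Real.rpow_mul (by norm_num)]; norm_num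
    have h0 : 0 ≤ (2 : ℝ) ^ (-(1 / 12 : ℝ)) := by positivity
    by_contra hlt
    push Not at hlt
    have := pow_lt_pow_left₀ hlt (by norm_num) (by norm_num : (12 : ℕ) ≠ 0)
    rw [h12] at this
    norm_num at this
  rw [inv_le_comm₀ (by linarith) (by norm_num)]
  linarith

/-- **The class sum with exponent `−1/12` is sub-power**: for every `ε > 0` there is `C ≥ 0` with
`Σ_{1 ≤ s ≤ X, s ∣ c^∞} s^{−1/12} ≤ C · c^{ε}` for all `c ≥ 1` and all `X` (`(1 − 2^{−1/12})⁻¹ ≤ 32 = 2⁵`, so the Euler product is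
`≤ τ(c)⁵`). [folklore] -/
theorem sum_rpow_neg_twelfth_factored_le {ε : ℝ} (hε : 0 < ε) :
    ∃ C : ℝ, 0 ≤ C ∧ ∀ (c : ℕ), c ≠ 0 → ∀ X : ℕ,
      ∑ s ∈ (Icc 1 X).filter (fun s ↦ s ∈ Nat.factoredNumbers c.primeFactors), ((s : ℝ)) ^ (-(1 / 12 : ℝ)) ≤
        C * (c : ℝ) ^ ε := by
  obtain ⟨C₁, hC₁1, hC₁⟩ := exists_card_divisors_le_mul_rpow (ε := ε / 5) (by positivity)
  refine ⟨C₁ ^ 5, by positivity, fun c hc X ↦ ?_⟩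
  have hc0 : (0 : ℝ) < c := by exact_mod_cast Nat.pos_of_ne_zero hc
  have h1 := sum_rpow_neg_factored_le_prod c (σ := 1 / 12) (by norm_num) X
  have h2 := prod_primeFactors_inv_le_pow c (σ := 1 / 12) (by norm_num)
  have hA0 : 0 ≤ (1 - (2 : ℝ) ^ (-(1 / 12 : ℝ)))⁻¹ := by
    have : (2 : ℝ) ^ (-(1 / 12 : ℝ)) < 1 := Real.rpow_lt_one_of_one_lt_of_neg (by norm_num) (by norm_num)
    exact inv_nonneg.mpr (by linarith)
  have h3 : ((1 - (2 : ℝ) ^ (-(1 / 12 : ℝ)))⁻¹) ^ c.primeFactors.card ≤ (32 : ℝ) ^ c.primeFactors.card :=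
    pow_le_pow_left₀ hA0 inv_one_sub_two_rpow_neg_twelfth_le _
  have h4 : (32 : ℝ) ^ c.primeFactors.card ≤ (#c.divisors : ℝ) ^ 5 := by
    rw [show (32 : ℝ) = 2 ^ 5 by norm_num, ← pow_mul, mul_comm, pow_mul]
    exact pow_le_pow_left₀ (by positivity) (two_pow_card_primeFactors_le hc) 5
  have h5 : (#c.divisors : ℝ) ^ 5 ≤ (C₁ * (c : ℝ) ^ (ε / 5)) ^ 5 := pow_le_pow_left₀ (Nat.cast_nonneg _) (hC₁ c hc) 5
  have h6 : (C₁ * (c : ℝ) ^ (ε / 5)) ^ 5 = C₁ ^ 5 * (c : ℝ) ^ ε := by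
    rw [mul_pow, ← Real.rpow_natCast ((c : ℝ) ^ (ε / 5)) 5, ← Real.rpow_mul hc0.le]
    norm_num
  calc _ ≤ _ := h1
    _ ≤ _ := h2
    _ ≤ _ := h3
    _ ≤ _ := h4
    _ ≤ _ := h5
    _ = _ := h6

/-! ## §2. Logarithms and the block/class summation -/

/-- **The log factors are sub-power**: `((1+log q̂)(1+2log q))^{i+j} · √(1+2log q) · (1+2log q)² ≤ C · q̂^{1/1000}` (`q ≥ 64`).
[folklore] -/
theorem logFactor_cube_le_rpow (i j : ℕ) :
    ∃ C : ℝ, 0 ≤ C ∧ ∀ (q : ℕ) [NeZero q], 64 ≤ q →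
      ((1 + Real.log (KMV2000.qhat q)) * (1 + 2 * Real.log q)) ^ (i + j) * Real.sqrt (1 + 2 * Real.log q) *
          (1 + 2 * Real.log q) ^ 2 ≤
        C * KMV2000.qhat q ^ (1 / 1000 : ℝ) := by
  set n : ℕ := 2 * (i + j) + 3 with hn
  set ε : ℝ := 1 / (1000 * n) with hεdef
  have hn0 : (0 : ℝ) < n := by rw [hn]; positivity
  have hε : 0 < ε := by rw [hεdef]; positivity
  refine ⟨9 ^ (i + j + 3) * (1 + ε⁻¹) ^ n, by positivity, fun q _ hq ↦ ?_⟩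
  have hqh1 : 1 < KMV2000.qhat q := one_lt_qhat hq
  have hlq : 0 ≤ Real.log (q : ℝ) :=
    Real.log_nonneg (by exact_mod_cast (le_trans (by norm_num) hq : 1 ≤ q))
  set x : ℝ := KMV2000.qhat q with hx
  have hL0 : 0 ≤ 1 + Real.log x := by linarith [Real.log_nonneg hqh1.le]
  have h9 := one_add_two_log_le (q := q) hq
  have hpow := one_add_log_pow_le_rpow hε n hqh1.le
  have hexp : ε * (n : ℝ) = 1 / 1000 := by
    rw [hεdef]; field_simp
  rw [hexp] at hpow
  have h1 : (1 : ℝ) ≤ 1 + 2 * Real.log q := by linarith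
  have hsqrt : Real.sqrt (1 + 2 * Real.log q) ≤ 1 + 2 * Real.log q := by
    rw [Real.sqrt_le_left (by linarith)]
    nlinarith
  calc ((1 + Real.log x) * (1 + 2 * Real.log q)) ^ (i + j) * Real.sqrt (1 + 2 * Real.log q) * (1 + 2 * Real.log q) ^ 2
      ≤ ((1 + Real.log x) * (9 * (1 + Real.log x))) ^ (i + j) * (9 * (1 + Real.log x)) * (9 * (1 + Real.log x)) ^ 2 := by
        refine mul_le_mul (mul_le_mul (pow_le_pow_left₀ (mul_nonneg hL0 (by linarith))
          (mul_le_mul_of_nonneg_left h9 hL0) _) (hsqrt.trans h9) (Real.sqrt_nonneg _) (by positivity))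
          (pow_le_pow_left₀ (by linarith) h9 2) (by positivity) (by positivity)
    _ = 9 ^ (i + j + 3) * (1 + Real.log x) ^ n := by
        have hsq : (1 + Real.log x) * (9 * (1 + Real.log x)) = 9 * (1 + Real.log x) ^ 2 := by ring
        rw [hn, hsq, mul_pow, ← pow_mul]; ring
    _ ≤ 9 ^ (i + j + 3) * ((1 + ε⁻¹) ^ n * x ^ (1 / 1000 : ℝ)) := mul_le_mul_of_nonneg_left hpow (by positivity)
    _ = _ := by ring

/-- The uniform class weight splits: `(s₁t₁s₂t₂)^{−1/12} = s₁^{−1/12} t₁^{−1/12} s₂^{−1/12} t₂^{−1/12}`. [folklore] -/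
theorem classWeight_split (s₁ t₁ s₂ t₂ : ℕ) :
    (((s₁ * t₁ * (s₂ * t₂) : ℕ) : ℝ)) ^ (-(1 / 12 : ℝ)) =
      (s₁ : ℝ) ^ (-(1 / 12 : ℝ)) * (t₁ : ℝ) ^ (-(1 / 12 : ℝ)) * ((s₂ : ℝ) ^ (-(1 / 12 : ℝ)) * (t₂ : ℝ) ^ (-(1 / 12 : ℝ))) := by
  push_cast
  rw [Real.mul_rpow (by positivity) (by positivity), Real.mul_rpow (by positivity) (by positivity),
    Real.mul_rpow (by positivity) (by positivity)]

/-- A four-fold sum of the split weights factors. [folklore] -/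
theorem sum_four_weights_mul_eq (A B C D : Finset ℕ) (K : ℝ) :
    ∑ a ∈ A, ∑ b ∈ B, ∑ c ∈ C, ∑ d ∈ D,
        K * ((a : ℝ) ^ (-(1 / 12 : ℝ)) * (b : ℝ) ^ (-(1 / 12 : ℝ)) * ((c : ℝ) ^ (-(1 / 12 : ℝ)) * (d : ℝ) ^ (-(1 / 12 : ℝ)))) =
      K * ((∑ a ∈ A, (a : ℝ) ^ (-(1 / 12 : ℝ))) * (∑ b ∈ B, (b : ℝ) ^ (-(1 / 12 : ℝ))) *
        ((∑ c ∈ C, (c : ℝ) ^ (-(1 / 12 : ℝ))) * (∑ d ∈ D, (d : ℝ) ^ (-(1 / 12 : ℝ))))) := by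
  rw [Finset.sum_mul_sum, Finset.sum_mul_sum, Finset.sum_mul, Finset.mul_sum]
  refine sum_congr rfl fun a _ ↦ ?_
  rw [Finset.sum_mul, Finset.mul_sum]
  refine sum_congr rfl fun b _ ↦ ?_
  rw [Finset.mul_sum, Finset.mul_sum]
  refine sum_congr rfl fun c _ ↦ ?_
  rw [Finset.mul_sum, Finset.mul_sum]

/-- **The block and class sum of the uniform weights**: with `S(X) = Σ_{s ≤ X, s ∣ (qr)^∞} s^{−1/12} ≤ T` for all `X`
(`T ≥ 0`) and `M ≤ q²` (`q ≥ 1`),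
`Σ_{d₁,d₂ ≤ M} Σ_{classes} G/(d₁d₂)·(s₁t₁s₂t₂)^{−1/12} ≤ G·(1+2log q)²·T⁴` (`G ≥ 0`). [folklore] -/
theorem sum_blocks_classes_le {q r M : ℕ} (hq : 1 ≤ q) (hM : M ≤ q ^ 2) {T : ℝ} (hT0 : 0 ≤ T)
    (hS : ∀ X : ℕ, ∑ s ∈ (Icc 1 X).filter (fun s ↦ s ∈ Nat.factoredNumbers (q * r).primeFactors),
      ((s : ℝ)) ^ (-(1 / 12 : ℝ)) ≤ T) {G : ℝ} (hG : 0 ≤ G) :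
    ∑ d₁ ∈ Icc 1 M, ∑ d₂ ∈ Icc 1 M,
      ∑ s₁ ∈ (Icc 1 (M / d₁)).filter (fun s ↦ s ∈ Nat.factoredNumbers (q * r).primeFactors),
      ∑ t₁ ∈ (Icc 1 (q ^ 2 / d₁)).filter (fun s ↦ s ∈ Nat.factoredNumbers (q * r).primeFactors),
      ∑ s₂ ∈ (Icc 1 (M / d₂)).filter (fun s ↦ s ∈ Nat.factoredNumbers (q * r).primeFactors),
      ∑ t₂ ∈ (Icc 1 (q ^ 2 / d₂)).filter (fun s ↦ s ∈ Nat.factoredNumbers (q * r).primeFactors),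
        G / ((d₁ : ℝ) * d₂) * (((s₁ * t₁ * (s₂ * t₂) : ℕ) : ℝ)) ^ (-(1 / 12 : ℝ)) ≤
      G * (1 + 2 * Real.log q) ^ 2 * T ^ 4 := by
  have hS0 : ∀ X : ℕ, 0 ≤ ∑ s ∈ (Icc 1 X).filter (fun s ↦ s ∈ Nat.factoredNumbers (q * r).primeFactors),
      ((s : ℝ)) ^ (-(1 / 12 : ℝ)) := fun X ↦ sum_nonneg fun s _ ↦ Real.rpow_nonneg (Nat.cast_nonneg _) _
  -- the inner four sums factor and are bounded by `T⁴`
  have hinner : ∀ d₁ d₂ : ℕ,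
      ∑ s₁ ∈ (Icc 1 (M / d₁)).filter (fun s ↦ s ∈ Nat.factoredNumbers (q * r).primeFactors),
      ∑ t₁ ∈ (Icc 1 (q ^ 2 / d₁)).filter (fun s ↦ s ∈ Nat.factoredNumbers (q * r).primeFactors),
      ∑ s₂ ∈ (Icc 1 (M / d₂)).filter (fun s ↦ s ∈ Nat.factoredNumbers (q * r).primeFactors),
      ∑ t₂ ∈ (Icc 1 (q ^ 2 / d₂)).filter (fun s ↦ s ∈ Nat.factoredNumbers (q * r).primeFactors),
        G / ((d₁ : ℝ) * d₂) * (((s₁ * t₁ * (s₂ * t₂) : ℕ) : ℝ)) ^ (-(1 / 12 : ℝ)) ≤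
      G / ((d₁ : ℝ) * d₂) * T ^ 4 := by
    intro d₁ d₂
    have e : ∑ s₁ ∈ (Icc 1 (M / d₁)).filter (fun s ↦ s ∈ Nat.factoredNumbers (q * r).primeFactors),
        ∑ t₁ ∈ (Icc 1 (q ^ 2 / d₁)).filter (fun s ↦ s ∈ Nat.factoredNumbers (q * r).primeFactors),
        ∑ s₂ ∈ (Icc 1 (M / d₂)).filter (fun s ↦ s ∈ Nat.factoredNumbers (q * r).primeFactors),
        ∑ t₂ ∈ (Icc 1 (q ^ 2 / d₂)).filter (fun s ↦ s ∈ Nat.factoredNumbers (q * r).primeFactors),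
          G / ((d₁ : ℝ) * d₂) * (((s₁ * t₁ * (s₂ * t₂) : ℕ) : ℝ)) ^ (-(1 / 12 : ℝ)) =
        ∑ s₁ ∈ (Icc 1 (M / d₁)).filter (fun s ↦ s ∈ Nat.factoredNumbers (q * r).primeFactors),
        ∑ t₁ ∈ (Icc 1 (q ^ 2 / d₁)).filter (fun s ↦ s ∈ Nat.factoredNumbers (q * r).primeFactors),
        ∑ s₂ ∈ (Icc 1 (M / d₂)).filter (fun s ↦ s ∈ Nat.factoredNumbers (q * r).primeFactors),
        ∑ t₂ ∈ (Icc 1 (q ^ 2 / d₂)).filter (fun s ↦ s ∈ Nat.factoredNumbers (q * r).primeFactors),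
          G / ((d₁ : ℝ) * d₂) * ((s₁ : ℝ) ^ (-(1 / 12 : ℝ)) * (t₁ : ℝ) ^ (-(1 / 12 : ℝ)) *
            ((s₂ : ℝ) ^ (-(1 / 12 : ℝ)) * (t₂ : ℝ) ^ (-(1 / 12 : ℝ)))) := by
      refine sum_congr rfl fun s₁ _ ↦ sum_congr rfl fun t₁ _ ↦ sum_congr rfl fun s₂ _ ↦ sum_congr rfl fun t₂ _ ↦ ?_
      rw [classWeight_split]
    rw [e, sum_four_weights_mul_eq]
    refine mul_le_mul_of_nonneg_left ?_ (by positivity)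
    calc _ ≤ T * T * (T * T) :=
          mul_le_mul (mul_le_mul (hS _) (hS _) (hS0 _) hT0) (mul_le_mul (hS _) (hS _) (hS0 _) hT0)
            (mul_nonneg (hS0 _) (hS0 _)) (by positivity)
      _ = T ^ 4 := by ring
  -- the block sums
  have hH : ∑ d ∈ Icc 1 M, ((d : ℝ))⁻¹ ≤ 1 + 2 * Real.log q := sum_Icc_inv_le_one_add_two_log hq hM
  have hH0 : 0 ≤ ∑ d ∈ Icc 1 M, ((d : ℝ))⁻¹ := sum_nonneg fun d _ ↦ by positivity
  calc _ ≤ ∑ d₁ ∈ Icc 1 M, ∑ d₂ ∈ Icc 1 M, G / ((d₁ : ℝ) * d₂) * T ^ 4 :=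
        sum_le_sum fun d₁ _ ↦ sum_le_sum fun d₂ _ ↦ hinner d₁ d₂
    _ = G * T ^ 4 * ((∑ d₁ ∈ Icc 1 M, ((d₁ : ℝ))⁻¹) * (∑ d₂ ∈ Icc 1 M, ((d₂ : ℝ))⁻¹)) := by
        rw [Finset.sum_mul_sum, Finset.mul_sum]
        refine sum_congr rfl fun d₁ _ ↦ ?_
        rw [Finset.mul_sum]
        refine sum_congr rfl fun d₂ _ ↦ ?_
        ring
    _ ≤ G * T ^ 4 * ((1 + 2 * Real.log q) * (1 + 2 * Real.log q)) :=
        mul_le_mul_of_nonneg_left (mul_le_mul hH hH hH0 (by linarith)) (by positivity)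
    _ = G * (1 + 2 * Real.log q) ^ 2 * T ^ 4 := by ring

end Summit.Parity.GeneralizedHardyLittlewood.Theorems.MomentsBeyondDiagonal.Layers

end
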